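import Literature.NumberTheory.EllipticCurves.IsogenyPotentiallyGoodMinimalDiscriminant
import Literature.NumberTheory.EllipticCurves.KellerYin2024.PotentiallyGoodOrdinaryPConverse
import HarnessLib

/-!
# Dokchitser–Dokchitser 2015, Thm. 5.1 (1), clause `l = p` ("the reduction is good or potentially
# ordinary"): every isogeny preserves the valuation of the minimal discriminant at a prime of
# potentially good ORDINARY reduction — ONE named fact (statement only)

Topic `Literature/NumberTheory/EllipticCurves`; namespace `Literature.NumberTheory.EllipticCurves`.
Companion of `IsogenyPotentiallyGoodMinimalDiscriminant.lean` (the clause `l ≠ p` of the SAME printed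
theorem, `dokchitser_padicValInt_minimalDiscriminantInt_eq_of_isogeny_of_not_dvd_degree`, discharged in
`IsogenyPotentiallyGoodMinimalDiscriminantProofs.lean`) and of `IsogenyNeronScalarPotSupersingular.lean`
(Gealy–Klagsbrun 2017: the potentially SUPERSINGULAR row at `l = p`, where `δ ≠ δ′`). Kept in its own
module only so that the sibling's ten importers do not acquire the import cone of the predicate
`WeierstrassCurve.HasPotentiallyGoodOrdinaryReductionAtPrime` (`KellerYin2024/…PConverse.lean`).
No definition of a new notion, no `instance`, no notation, no `sorry`; +1 declared debt (D-0026;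
consumer named below).

## The print (T. Dokchitser, V. Dokchitser, *Local invariants of isogenous elliptic curves*, Trans.
## Amer. Math. Soc. 367 (2015) 4339–4358 = arXiv:1208.5519, store `paper:arxiv-1208.5519`; TAMS
## numbering as in the sibling file, arXiv numbering in brackets)

* §1.1 Notation (p. 4341; store p0004 L23–33): "`p` is a prime number, and `φ : E → E′` an isogeny
  of elliptic curves of degree `p` … the base field `K` is a finite extension of `ℚ_l`; `l = p` is
  allowed"; "`Δ, Δ′` minimal discriminants of `E/K` and `E′/K`", "`δ = v(Δ), δ′ = v(Δ′)`". §1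
  (p. 4339; store p0003 L6–8): "every isogeny factors as a composition of endomorphisms and
  isogenies of prime degree".
* **Theorem 5.1 (1)** [Thm. 19 (1)] (store p0009 L3–6), VERBATIM: "If `E` has potentially good
  reduction, and either `l ≠ p` or the reduction is good or potentially ordinary, then `δ = δ′`."
  Printed proof of the clause typed here (store p0009 L35–40): "We are left with the case that `E`
  has additive potentially ordinary reduction with `l = p`. If `p > 3`, the claim is proved in
  Corollary (delpotord5). If `p = 2, 3`, then `E/K` is a quadratic twist of a curve `E_d/K` with good
  ordinary reduction (Theorem (potordkod)) …" (and "If `E` has good reduction, then `δ = δ′ = 0`",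
  L9).
* [Cor. 8] = (delpotord5) (§3; store p0006 L77–83), VERBATIM: "Suppose `l = p` and `E` has additive
  tame potentially good reduction. If the reduction is potentially ordinary, then `δ = δ′` and
  `E, E′` have the same Kodaira type. If the reduction is potentially supersingular, then
  `δ = 12 − δ′` and `E, E′` have opposite Kodaira types (II ↔ II*, III ↔ III*, IV ↔ IV*,
  I₀* ↔ I₀*)" — proved (L85–105) from [Thm. 6] (`0 < δ, δ′ < 12`, `δ′ ≡ pδ mod 12`, the congruence
  being [Thm. 3] = Coates: `Δ^p/Δ′ ∈ K^{×12}` for a `p`-isogeny, `p > 3`) and [Thm. 7] =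
  (potordkod) (store p0006 L34–75: `E/K` additive potentially good, not a quadratic twist of good
  reduction ⇒ `l ≡ 1 mod 12`: potentially ordinary; `l ≡ 5 mod 12`: potentially ordinary iff type
  III/III*; `l ≡ 7 mod 12`: iff II/II*/IV/IV*; `l ∈ {2,3}` or `l ≡ −1 mod 12`: potentially
  supersingular).
* Table 1 (p. 4340; store p0003 L71), row "additive pot. good, `l = p` pot. ordinary": `δ′ = δ`,
  `φ^*ω′/ω = 1 or p (†)`, Kodaira types "same"; Theorem 5.4 (2) [Thm. 22 (2)] (store p0009 L74–75):
  "If `E` has potentially good ordinary reduction and `p = l`, then the Kodaira types of `E` and `E′`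
  are the same."  [Rem. 21] (store p0009 L57–66): at a potentially SUPERSINGULAR `l = p` the
  conclusion fails — "`E = 50b1`, `E′ = 50b3` … `5`-isogenous … types II and II* … so `δ ≠ δ′`".

## What is typed, and why it follows from the page

Data dictionary as in the sibling file: `W, W′/ℚ` elliptic in GLOBALLY MINIMAL Weierstrass models
(so the model is minimal at `p` and `padicValInt p W.minimalDiscriminantInt = v_p(Δ_min) = δ` of
`W ⊗ ℚ_p`; the tree's prime `p` is the print's residue characteristic `l`). HYPOTHESES: `W ∼ W′`
over `ℚ` (`IsIsogenous W W′`: some `ℚ`-isogeny, of any degree) and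
`W.HasPotentiallyGoodOrdinaryReductionAtPrime p` (good reduction WITH the unit-root condition of
`W_F` at some place `w ∣ p` of some number field `F` — the print's "`E` has potentially good
reduction, and the reduction is good or potentially ordinary"; the choice of `(F, w)` is
immaterial, Silverman *AEC* VII.5.4, and the predicate contains "potentially good":
`HasPotentiallyGoodOrdinaryReductionAtPrime.padicValRat_j_nonneg`, `0 ≤ v_p(j(W))`, *AEC* VII.5.5).
CONCLUSION: `v_p(Δ_min(W)) = v_p(Δ_min(W′))`. From the print: over `ℚ` the isogeny is `ψ ∘ [n]`
with `ψ` a composition of `ℚ`-isogenies of prime degrees `p_i` (§1); `[n]` changes nothing; every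
intermediate curve is again potentially good ordinary at `p` (isogenous curves acquire good
reduction at the same places, *AEC* Cor. VII.7.2 — tree theorem
`IsIsogenous.hasGoodReductionAt_iff_of_isIsogenous` — with isogenous, hence equally ordinary,
reductions); a factor with `p_i ≠ p` is the clause `l ≠ p` of Thm. 5.1 (1), a factor with
`p_i = p` its clause "good or potentially ordinary", each read over `K = ℚ_p`; so the valuations
agree along the chain. No restriction on `p`: the print proves the clause for `p = 2, 3` too.

NOT transcribed, and why. (i) The Kodaira-type wording of [Cor. 8] / Thm. 5.4 (2) ("same Kodaira
type"): at a potentially good additive `p ≥ 5` the type is a function of `δ ∈ {2,3,4,6,8,9,10}`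
(*ATAEC* IV Table 4.1), so it follows in-tree from `δ = δ′`. (ii) The scalar row
"`φ^*ω′/ω = 1 or p (†)`" of Table 1 / [Prop. 17]: over `ℚ`, between globally minimal models, the
Néron scalings `n_φ, n_φ̂ ∈ ℤ` of a `p`-isogeny and its dual (tree
`integral_neronScaling_of_isGloballyMinimal`, discharged) satisfy `n_φ n_φ̂ = p`, so
`n_φ ∈ {±1, ±p}` needs no fact; the printed content is the criterion (†) "`= p` iff
`ker φ ⊂ Ê(𝔪)`", which has no expression in the tree's lattice currency. (iii) The potentially
supersingular flip `δ = 12 − δ′` with its scalar is the tree's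
`gealyKlagsbrun2017_neronScalar_of_additive_potSupersingular`.

WHY NOT A THEOREM YET (2026-08-28). The discharge of the sibling clause transports the isogeny to
`w`-minimal good models over a good-reduction field and uses that its multiplier `k ∈ ℤ`,
`k ∣ deg φ`, is a `w`-unit when `p ∤ deg φ` (`padicValInt_minimalDiscriminantInt_le_of_isogeny_of_isMinimalAt`);
for `deg φ = p` the same bookkeeping only gives `|δ − δ′| ≤ 12`, and `δ = δ′` needs the ORDINARY
input "one of the two transported multipliers (of `φ` and of `φ̂`) is a `w`-unit" ([Prop. 16]: `[p]`
has height `1` on the reduced ordinary curve, so `φ̃` or `φ̃ᵗ` is separable), i.e. reduction of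
isogenies modulo `w` together with the separability criterion on invariant differentials — not in
the tree. (The flip cases are exactly those with both multipliers of valuation strictly between `0`
and `w(p)`.)

## Consumers

* Route `TwistFamilyManinDescent`, glue item `EisensteinResidualOfTrichotomy`
  (stmt-BirchSwinnertonDyer-25945), lemma g2 "TYPE RIGIDITY" at `p = 13` (its docstring: "the
  not-yet-transcribed «potentially ordinary» clause of Thm 5.1(1) next to the tree's
  `dokchitser_padicValInt_minimalDiscriminantInt_eq_of_isogeny_of_not_dvd_degree`"): for the optimal
  curve `W` and a `13`-isogenous globally minimal `W′`, additive potentially good and (G)-ORDINARY at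
  `13`, `v₁₃ Δ_min(W) = v₁₃ Δ_min(W′)`. Feed `(h : dokchitser_…_of_potentiallyGoodOrdinary)` with
  `IsIsogenous W W′` (from a lattice inclusion: `isIsogenous_of_forall_mul_mem_lattice`,
  `NeronIsogenyScaling.lean`) and `TypeGOrd W 13 → W.HasPotentiallyGoodOrdinaryReductionAtPrime 13`
  (`Summit.….hasPotentiallyGoodOrdinaryReductionAtPrime_of_typeGOrd`,
  `Summits/…/Theorems/AdditiveBranchIMCGordTwoRankOneCM.lean`).
* The remark "IN PRINT (not typed here)" of
  `Summits/BirchSwinnertonDyer/Rank1Residual/Additive/GordIsogenyInvarianceClasses.lean`: on the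
  (G-ord) locus the swap `v ↦ 12 − v` allowed by
  `padicValInt_minimalDiscriminantInt_eq_or_add_eq_twelve_of_isIsogenous_of_typeG` never occurs, so
  Edixhoven's exception bit `ord_p Δ_min ≤ 4` (routes `AdditiveKolyvaginRoad`,
  `EdixhovenFibreFiveSeven`, `TeichmullerTwistDescent`) is a CLASS invariant on (G-ord) classes —
  exactly this fact.

## References
* [DokchitserDokchitser2015LocalInvariants] T. Dokchitser, V. Dokchitser, Trans. Amer. Math. Soc.
  367 (2015) 4339–4358: Thm. 5.1 (1), Thm. 5.4 (2), Table 1, §3 (arXiv Thm. 6, Thm. 7, Cor. 8), §4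
  (arXiv Props. 16–17), Remark after Thm. 5.1 (arXiv Rem. 21); arXiv:1208.5519 Thm. 19 (1), Thm. 22 (2).
* [SilvermanAEC2009] J. H. Silverman, *The Arithmetic of Elliptic Curves*, VII.5 (Definition
  p. 197, Prop. VII.5.4, Prop. VII.5.5), Cor. VII.7.2, §VIII.8.
* [GealyKlagsbrun2017] M. Gealy, Z. Klagsbrun, arXiv:1703.02148, Thm. 1 (tree
  `IsogenyNeronScalarPotSupersingular.lean`).
-/

namespace Literature.NumberTheory.EllipticCurves

open _root_.WeierstrassCurve

/-- **Dokchitser–Dokchitser 2015, Thm. 5.1 (1), clause `l = p`, "the reduction is good or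
potentially ordinary" (every isogeny preserves the valuation of the minimal discriminant at a prime
of potentially good ORDINARY reduction).** Printed (Trans. AMS 367, §5 Thm. 5.1 (1);
arXiv:1208.5519 Thm. 19 (1), store `paper:arxiv-1208.5519` p0009 L3–6): "If `E` has potentially
good reduction, and either `l ≠ p` or the reduction is good or potentially ordinary, then
`δ = δ′`" — `φ : E → E′` an isogeny of prime degree `p` over a finite extension `K` of `ℚ_l`
(§1.1), `δ, δ′` the valuations of the minimal discriminants; printed proof of this clause p0009
L35–40 ("If `p > 3`, the claim is proved in Corollary 8" — §3, store p0006 L77–81: `l = p`,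
additive tame potentially good, potentially ordinary ⇒ `δ = δ′` and same Kodaira type — "If
`p = 2, 3`, then `E/K` is a quadratic twist of a curve `E_d/K` with good ordinary reduction …");
Table 1 (p. 4340, store p0003 L71) row "additive pot. good, `l = p` pot. ordinary": `δ′ = δ`.
DATA: `W, W′/ℚ` elliptic, globally minimal models (minimal at `p`, so
`δ = padicValInt p W.minimalDiscriminantInt`); `W ∼ W′` over `ℚ` (`IsIsogenous`, any degree: §1
"every isogeny factors as a composition of endomorphisms and isogenies of prime degree" — factors
of degree `≠ p` are the sibling clause `l ≠ p`, factors of degree `p` this clause, every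
intermediate curve being again potentially good ordinary at `p`; module docstring); HYPOTHESIS
`W.HasPotentiallyGoodOrdinaryReductionAtPrime p` (good ordinary reduction of `W_F` at some place
above `p` of some number field `F` = the print's "potentially good, and the reduction is good or
potentially ordinary"; it contains `0 ≤ v_p(j(W))`,
`HasPotentiallyGoodOrdinaryReductionAtPrime.padicValRat_j_nonneg`). CONCLUSION:
`v_p(Δ_min(W)) = v_p(Δ_min(W′))`. No restriction on `p` (the print covers `p = 2, 3`). NOT
transcribed here (module docstring, with reasons): the Kodaira-type wording of Cor. 8 /
Thm. 5.4 (2), the scalar row `φ^*ω′/ω = 1 or p (†)` ([Prop. 17]), the potentially supersingular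
flip `δ = 12 − δ′` ([Rem. 21]: `50b1 → 50b3` at `l = p = 5`; tree
`gealyKlagsbrun2017_neronScalar_of_additive_potSupersingular`). PUBLISHED (refereed). Named fact
(statement only; why not yet a theorem: module docstring).
[cite: DokchitserDokchitser2015LocalInvariants, Thm. 5.1 (1) clause "good or potentially ordinary" (arXiv:1208.5519 Thm. 19 (1), store p0009 L3–6, proof L35–40) with Cor. 8 (§3, store p0006 L77–81) and Table 1 (p. 4340, store p0003 L71)]
[cite: SilvermanAEC2009, VII.5 Definition p. 197 with Prop. VII.5.4–5.5 (potential good reduction; independence of the good-reduction field; j integral)] -/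
def dokchitser_padicValInt_minimalDiscriminantInt_eq_of_isogeny_of_potentiallyGoodOrdinary : Prop :=
  ∀ (W W' : WeierstrassCurve ℚ) [W.IsElliptic] [W'.IsElliptic] [W.IsGloballyMinimal]
    [W'.IsGloballyMinimal] (p : ℕ), p.Prime → IsIsogenous W W' →
    W.HasPotentiallyGoodOrdinaryReductionAtPrime p →
    padicValInt p W.minimalDiscriminantInt = padicValInt p W'.minimalDiscriminantInt

end Literature.NumberTheory.EllipticCurves
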